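import Literature.AlgebraicGeometry.Resolution.KnafKuhlmann2009Thm11Parts
import Mathlib.FieldTheory.IsSepClosed
import Mathlib.RingTheory.Valuation.ValuationSubring
import HarnessLib

/-!
# Transport of the ambient vocabulary of valued function fields along a field embedding

Topic: `Literature/AlgebraicGeometry/Resolution`. The named facts on valued function fields of
this topic are rendered "ambiently" (`ValuedFunctionFields.lean`, `KnafKuhlmann2009Thm11Parts.lean`):
one valued field `(Ω, V)` and subfields `K ≤ F ≤ Ω`, with `O_E = V ∩ E`. Some facts are stated
for an ARBITRARY ambient field `Ω` (e.g. `KnafKuhlmann2009_Thm38_sepClosed`,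
`KnafKuhlmann2009HenselianRationality.lean`), others need `Ω` ALGEBRAICALLY CLOSED — everything
phrased with the henselization `henselization V E ⊆ Ω` of `Henselization.lean`, which is the
decomposition field of `V ∩ E^{sep}` and is the henselization only when `E^{sep} ⊆ Ω`. To pass
from the second kind to the first, one embeds `Ω` in an algebraic closure `Ω̄`, extends `V` to a
valuation ring `V̄` of `Ω̄` with `V̄ ∩ Ω = V` (`exists_valuationSubring_comap_eq`,
`SmoothUniformization.lean`) and transports hypotheses forth and conclusions back along
`ι : Ω → Ω̄`.

This file proves the transport lemmas, for an arbitrary homomorphism of fields `ι : Ω →+* Ω'`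
(and, where values matter, valuation rings `V ≤ Ω`, `V' ≤ Ω'` with `ι⁻¹(V') = V`):

* `exists_ringEquiv_map`, `exists_ringEquiv_adjoin_map` — `K ≃ ι(K)` and `K(s) ≃ ι(K)(ι(s))`
  compatibly with `ι` (stated as existence theorems, so that this file defines nothing);
  `mem_adjoin_iff_mem_closure`, `map_closure_union`.
* `transcendental_map_iff`, `isAlgebraic_adjoin_map_iff`, `isSeparable_adjoin_map`,
  `algebraicIndependent_finset_image` — transcendence, algebraicity and separability over `K`
  resp. `K(s)`, and algebraic independence over `K`, along `ι` (from Mathlib's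
  `transcendental_ringHom_iff_of_comp_eq`, `isAlgebraic_ringHom_iff_of_comp_eq`,
  `IsSeparable.of_equiv_equiv`, `algebraicIndependent_ringHom_iff_of_comp_eq`).
* `fgOver_map`, `finiteOver_map`, `separablyGeneratedOver_map`, `exists_transcendental_map` — the
  hypotheses "`F|K` finitely generated / finite / separably generated / of transcendence degree
  `1`" pass to `ι(F)|ι(K)`.
* `isEquiv_valuation_comap` — `V'.valuation ∘ ι` is equivalent to `V.valuation` when
  `ι⁻¹(V') = V`; `isImmediateOver_map` — "`(F|K, V)` immediate" passes to `(ι(F)|ι(K), V')`.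
* `isSepClosed_of_ringEquiv`, `isSepClosed_map` — separable closedness along a ring isomorphism
  (Mathlib has `IsSepClosed.of_exists_root` but no transport lemma).

All statements are [folklore]; nothing here is specific to a source.
-/

noncomputable section

open Polynomial IsLocalRing

namespace Literature.AlgebraicGeometry.Resolution

variable {Ω Ω' : Type*} [Field Ω] [Field Ω'] (ι : Ω →+* Ω')

/-! ## Subfields, adjunctions and their images -/

/-- A subfield `K ≤ Ω` is isomorphic to its image `ι(K) ≤ Ω'`, compatibly with `ι`. [folklore] -/
theorem exists_ringEquiv_map (S : Subfield Ω) :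
    ∃ e : S ≃+* S.map ι, ∀ z : S, ((e z : S.map ι) : Ω') = ι z := by
  let f : S →+* S.map ι := (ι.comp S.subtype).codRestrict (S.map ι)
    fun z => Subfield.mem_map.mpr ⟨z, z.2, rfl⟩
  have hf : Function.Bijective f := by
    refine ⟨fun a b h => Subtype.ext (ι.injective (congrArg Subtype.val h)), fun w => ?_⟩
    obtain ⟨z, hz, hzw⟩ := Subfield.mem_map.mp w.2
    exact ⟨⟨z, hz⟩, Subtype.ext hzw⟩
  exact ⟨RingEquiv.ofBijective f hf, fun z => rfl⟩

/-- Membership in `K(s)` (Mathlib's intermediate field `IntermediateField.adjoin K s` of `Ω`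
over the subfield `K`) is membership in the subfield generated by `K ∪ s`. [folklore] -/
theorem mem_adjoin_iff_mem_closure (S : Subfield Ω) (s : Set Ω) (z : Ω) :
    z ∈ IntermediateField.adjoin S s ↔ z ∈ Subfield.closure ((S : Set Ω) ∪ s) := by
  have hr : Set.range (algebraMap S Ω) = (S : Set Ω) := by
    ext y
    constructor
    · rintro ⟨w, rfl⟩
      exact w.2
    · intro hy
      exact ⟨⟨y, hy⟩, rfl⟩
  rw [← IntermediateField.mem_toSubfield, IntermediateField.adjoin_toSubfield, hr]

/-- `ι` maps the subfield generated by `K ∪ s` onto the subfield generated by `ι(K) ∪ ι(s)`.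
[folklore] -/
theorem map_closure_union (S : Subfield Ω) (s : Set Ω) :
    (Subfield.closure ((S : Set Ω) ∪ s)).map ι =
      Subfield.closure ((S.map ι : Set Ω') ∪ ι '' s) := by
  rw [RingHom.map_field_closure, Set.image_union, Subfield.coe_map]

/-- `z ∈ K(s)` iff `ι z ∈ ι(K)(ι(s))`. [folklore] -/
theorem map_mem_adjoin_iff (S : Subfield Ω) (s : Set Ω) (z : Ω) :
    ι z ∈ IntermediateField.adjoin (S.map ι) (ι '' s) ↔ z ∈ IntermediateField.adjoin S s := by
  rw [mem_adjoin_iff_mem_closure, mem_adjoin_iff_mem_closure, ← map_closure_union,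
    ← Subfield.mem_comap, Subfield.comap_map]

/-- `K(s) ≃ ι(K)(ι(s))` compatibly with `ι`. [folklore] -/
theorem exists_ringEquiv_adjoin_map (S : Subfield Ω) (s : Set Ω) :
    ∃ e : IntermediateField.adjoin S s ≃+* IntermediateField.adjoin (S.map ι) (ι '' s),
      ∀ z : IntermediateField.adjoin S s,
        ((e z : IntermediateField.adjoin (S.map ι) (ι '' s)) : Ω') = ι z := by
  let f : IntermediateField.adjoin S s →+* IntermediateField.adjoin (S.map ι) (ι '' s) :=
    (ι.comp (algebraMap (IntermediateField.adjoin S s) Ω)).codRestrict _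
      fun z => (map_mem_adjoin_iff ι S s z).mpr z.2
  have hf : Function.Bijective f := by
    refine ⟨fun a b h => Subtype.ext (ι.injective (congrArg Subtype.val h)), fun w => ?_⟩
    have hw := (mem_adjoin_iff_mem_closure (S.map ι) (ι '' s) (w : Ω')).mp w.2
    rw [← map_closure_union] at hw
    obtain ⟨z, hz, hzw⟩ := Subfield.mem_map.mp hw
    exact ⟨⟨z, (mem_adjoin_iff_mem_closure S s z).mpr hz⟩, Subtype.ext hzw⟩
  exact ⟨RingEquiv.ofBijective f hf, fun z => rfl⟩

/-! ## Algebraicity, transcendence, separability, algebraic independence -/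

/-- Transcendence over `K` is invariant under `ι`. [folklore] -/
theorem transcendental_map_iff (S : Subfield Ω) (x : Ω) :
    Transcendental (S.map ι) (ι x) ↔ Transcendental S x := by
  obtain ⟨e, he⟩ := exists_ringEquiv_map ι S
  exact transcendental_ringHom_iff_of_comp_eq e ι ι.injective (RingHom.ext fun z => he z)

/-- Algebraicity over `K(s)` is invariant under `ι`. [folklore] -/
theorem isAlgebraic_adjoin_map_iff (S : Subfield Ω) (s : Set Ω) (z : Ω) :
    IsAlgebraic (IntermediateField.adjoin (S.map ι) (ι '' s)) (ι z) ↔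
      IsAlgebraic (IntermediateField.adjoin S s) z := by
  obtain ⟨e, he⟩ := exists_ringEquiv_adjoin_map ι S s
  exact isAlgebraic_ringHom_iff_of_comp_eq e ι ι.injective (RingHom.ext fun w => he w)

/-- Separability over `K(s)` passes along `ι`. [folklore] -/
theorem isSeparable_adjoin_map (S : Subfield Ω) (s : Set Ω) {z : Ω}
    (hz : IsSeparable (IntermediateField.adjoin S s) z) :
    IsSeparable (IntermediateField.adjoin (S.map ι) (ι '' s)) (ι z) := by
  obtain ⟨e, he⟩ := exists_ringEquiv_adjoin_map ι S s
  letI : Algebra (IntermediateField.adjoin S s) Ω' :=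
    (ι.comp (algebraMap (IntermediateField.adjoin S s) Ω)).toAlgebra
  let ιa : Ω →ₐ[IntermediateField.adjoin S s] Ω' := { ι with commutes' := fun _ => rfl }
  have h1 : IsSeparable (IntermediateField.adjoin S s) (ι z) := hz.map ιa ι.injective
  exact IsSeparable.of_equiv_equiv e (RingEquiv.refl Ω') (RingHom.ext fun w => he w) h1

/-- Algebraic independence over `K` of a finite set passes to its image over `ι(K)`. [folklore] -/
theorem algebraicIndependent_finset_image [DecidableEq Ω'] (S : Subfield Ω) (t : Finset Ω)
    (ht : AlgebraicIndependent S ((↑) : t → Ω)) :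
    AlgebraicIndependent (S.map ι) ((↑) : t.image ι → Ω') := by
  obtain ⟨e, he⟩ := exists_ringEquiv_map ι S
  have h1 : AlgebraicIndependent (S.map ι) (ι ∘ ((↑) : t → Ω)) :=
    (algebraicIndependent_ringHom_iff_of_comp_eq e ι ι.injective (RingHom.ext fun w => he w)).mpr
      ht
  have h2 := h1.coe_range
  have hr : Set.range (ι ∘ ((↑) : t → Ω)) = ((t.image ι : Finset Ω') : Set Ω') := by
    ext y
    simp only [Set.range_comp, Set.mem_image, Set.mem_range, Subtype.exists, exists_prop,
      exists_eq_right, Finset.coe_image, Finset.mem_coe]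
  rw [hr] at h2
  exact h2

/-! ## Hypotheses on `F|K` -/

/-- `F|K` finitely generated ⇒ `ι(F)|ι(K)` finitely generated. [folklore] -/
theorem fgOver_map [DecidableEq Ω'] {K F : Subfield Ω} (h : FGOver K F) :
    FGOver (K.map ι) (F.map ι) := by
  obtain ⟨s, hs⟩ := h
  refine ⟨s.image ι, ?_⟩
  rw [Finset.coe_image, ← map_closure_union, hs]

/-- `F|K` finite ⇒ `ι(F)|ι(K)` finite. [folklore] -/
theorem finiteOver_map [DecidableEq Ω'] {K F : Subfield Ω} (h : FiniteOver K F) :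
    FiniteOver (K.map ι) (F.map ι) := by
  obtain ⟨s, hsalg, hs⟩ := h
  obtain ⟨e, he⟩ := exists_ringEquiv_map ι K
  refine ⟨s.image ι, fun y hy => ?_, ?_⟩
  · obtain ⟨x, hx, rfl⟩ := Finset.mem_image.mp hy
    exact (isAlgebraic_ringHom_iff_of_comp_eq e ι ι.injective (RingHom.ext fun w => he w)).mpr
      (hsalg x hx)
  · rw [Finset.coe_image, ← map_closure_union, hs]

/-- `F|K` separably generated ⇒ `ι(F)|ι(K)` separably generated (the image of a separating
transcendence basis is one). [folklore] -/
theorem separablyGeneratedOver_map [DecidableEq Ω'] {K F : Subfield Ω}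
    (h : SeparablyGeneratedOver K F) : SeparablyGeneratedOver (K.map ι) (F.map ι) := by
  obtain ⟨t, htF, hind, hsep⟩ := h
  refine ⟨t.image ι, ?_, algebraicIndependent_finset_image ι K t hind, fun y hy => ?_⟩
  · rw [Finset.coe_image]
    rintro _ ⟨x, hx, rfl⟩
    exact Subfield.mem_map.mpr ⟨x, htF hx, rfl⟩
  · obtain ⟨z, hz, rfl⟩ := Subfield.mem_map.mp hy
    rw [Finset.coe_image]
    exact isSeparable_adjoin_map ι K (t : Set Ω) (hsep z hz)

/-- "`F|K` has transcendence degree `1`" (some `x ∈ F` transcendental over `K` with `F`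
algebraic over `K(x)`) passes to `ι(F)|ι(K)`. [folklore] -/
theorem exists_transcendental_map {K F : Subfield Ω}
    (h : ∃ x ∈ F, Transcendental K x ∧
      ∀ z ∈ F, IsAlgebraic (IntermediateField.adjoin K ({x} : Set Ω)) z) :
    ∃ x ∈ F.map ι, Transcendental (K.map ι) x ∧
      ∀ z ∈ F.map ι, IsAlgebraic (IntermediateField.adjoin (K.map ι) ({x} : Set Ω')) z := by
  obtain ⟨x, hxF, hx, halg⟩ := h
  refine ⟨ι x, Subfield.mem_map.mpr ⟨x, hxF, rfl⟩, (transcendental_map_iff ι K x).mpr hx,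
    fun y hy => ?_⟩
  obtain ⟨z, hz, rfl⟩ := Subfield.mem_map.mp hy
  rw [← Set.image_singleton]
  exact (isAlgebraic_adjoin_map_iff ι K {x} z).mpr (halg z hz)

/-! ## Values and residues -/

/-- If `ι⁻¹(V') = V`, the valuation `V'.valuation ∘ ι` of `Ω` is equivalent to `V.valuation`
(they have the same valuation ring). [folklore] -/
theorem isEquiv_valuation_comap {V : ValuationSubring Ω} {V' : ValuationSubring Ω'}
    (hV : V'.comap ι = V) : (V'.valuation.comap ι).IsEquiv V.valuation := by
  rw [Valuation.isEquiv_iff_valuationSubring, ValuationSubring.valuationSubring_valuation, ← hV]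
  ext x
  rw [Valuation.mem_valuationSubring_iff, Valuation.comap_apply, ValuationSubring.mem_comap,
    ValuationSubring.valuation_le_one_iff]

/-- With `ι⁻¹(V') = V`: `v'(ι a) = v'(ι b) ↔ v(a) = v(b)`. [folklore] -/
theorem valuation_map_eq_iff {V : ValuationSubring Ω} {V' : ValuationSubring Ω'}
    (hV : V'.comap ι = V) (a b : Ω) :
    V'.valuation (ι a) = V'.valuation (ι b) ↔ V.valuation a = V.valuation b :=
  (isEquiv_valuation_comap ι hV).eq_iff

/-- With `ι⁻¹(V') = V`: `v'(ι a) = 1 ↔ v(a) = 1`. [folklore] -/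
theorem valuation_map_eq_one_iff {V : ValuationSubring Ω} {V' : ValuationSubring Ω'}
    (hV : V'.comap ι = V) (a : Ω) : V'.valuation (ι a) = 1 ↔ V.valuation a = 1 := by
  have h := (isEquiv_valuation_comap ι hV).eq_iff (r := a) (s := 1)
  simpa only [Valuation.comap_apply, map_one] using h

/-- With `ι⁻¹(V') = V`: `v'(ι a) < 1 ↔ v(a) < 1`. [folklore] -/
theorem valuation_map_lt_one_iff {V : ValuationSubring Ω} {V' : ValuationSubring Ω'}
    (hV : V'.comap ι = V) (a : Ω) : V'.valuation (ι a) < 1 ↔ V.valuation a < 1 :=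
  (isEquiv_valuation_comap ι hV).lt_one_iff_lt_one

/-- **Immediate extensions are transported**: if `(F|K, V)` is immediate and `ι⁻¹(V') = V`,
then `(ι(F)|ι(K), V')` is immediate. [folklore] -/
theorem isImmediateOver_map {V : ValuationSubring Ω} {V' : ValuationSubring Ω'}
    (hV : V'.comap ι = V) {K F : Subfield Ω} (h : IsImmediateOver V K F) :
    IsImmediateOver V' (K.map ι) (F.map ι) := by
  refine ⟨fun a' ha' ha'0 => ?_, fun r hr => ?_⟩
  · obtain ⟨a, haF, rfl⟩ := Subfield.mem_map.mp ha'
    have ha0 : a ≠ 0 := fun h0 => ha'0 (by rw [h0, map_zero])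
    obtain ⟨b, hbK, hab⟩ := h.1 a haF ha0
    exact ⟨ι b, Subfield.mem_map.mpr ⟨b, hbK, rfl⟩, (valuation_map_eq_iff ι hV a b).mpr hab⟩
  · obtain ⟨a', ha'F, rfl⟩ := (mem_resField_iff V' (F.map ι) r).mp hr
    obtain ⟨a, haF, haa'⟩ := Subfield.mem_map.mp ha'F
    have haV : a ∈ V := by
      rw [← hV, ValuationSubring.mem_comap, haa']
      exact a'.2
    -- the residue of `a` is the residue of some `b ∈ V ∩ K`
    obtain ⟨b, hbK, hb⟩ := (mem_resField_iff V K _).mp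
      (h.2 (residue_mem_resField V ⟨a, haV⟩ haF))
    have hbV' : ι b ∈ V' := by
      rw [← ValuationSubring.mem_comap, hV]
      exact b.2
    refine (mem_resField_iff V' (K.map ι) _).mpr
      ⟨⟨ι b, hbV'⟩, Subfield.mem_map.mpr ⟨b, hbK, rfl⟩, ?_⟩
    -- `b - a ∈ 𝔪_V`, hence `ι b - ι a ∈ 𝔪_{V'}`
    have hsub : b - ⟨a, haV⟩ ∈ maximalIdeal V := Ideal.Quotient.eq.mp hb
    rw [ValuationSubring.valuation_lt_one_iff] at hsub
    have hsub' : (⟨ι b, hbV'⟩ : V') - a' ∈ maximalIdeal V' := by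
      rw [ValuationSubring.valuation_lt_one_iff]
      have : ((⟨ι b, hbV'⟩ - a' : V') : Ω') = ι ((b : Ω) - a) := by
        rw [map_sub, haa']
        rfl
      rw [this, valuation_map_lt_one_iff ι hV]
      exact hsub
    exact Ideal.Quotient.eq.mpr hsub'

/-! ## Separable closedness -/

/-- Separable closedness is invariant under ring isomorphisms. [folklore] -/
theorem isSepClosed_of_ringEquiv {A B : Type*} [Field A] [Field B] [IsSepClosed A]
    (e : A ≃+* B) : IsSepClosed B := by
  refine IsSepClosed.of_exists_root B fun p _ hirr hsep => ?_
  set q : Polynomial A := p.map (e.symm : B →+* A) with hq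
  have hqsep : q.Separable := hsep.map
  have hqdeg : q.degree ≠ 0 := by
    rw [hq, Polynomial.degree_map]
    exact (Polynomial.degree_pos_of_irreducible hirr).ne'
  obtain ⟨x, hx⟩ := IsSepClosed.exists_root q hqdeg hqsep
  refine ⟨e x, ?_⟩
  have h : (e : A →+* B) (q.eval x) = 0 := by rw [hx, map_zero]
  rw [hq, Polynomial.eval_map, Polynomial.hom_eval₂] at h
  have hcomp : (e : A →+* B).comp (e.symm : B →+* A) = RingHom.id B := by
    ext b
    simp
  rw [hcomp] at h
  exact h

/-- The image `ι(K)` of a separably closed subfield `K` is separably closed. [folklore] -/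
theorem isSepClosed_map (K : Subfield Ω) [IsSepClosed K] : IsSepClosed (K.map ι) := by
  obtain ⟨e, -⟩ := exists_ringEquiv_map ι K
  exact isSepClosed_of_ringEquiv e

/-! ## Polynomials -/

/-- A polynomial over `Ω'` with coefficients in `ι(L)` is the image of a polynomial over `Ω`
with coefficients in `L`, monic if it is. [folklore] -/
theorem exists_map_eq_of_coeff_mem_map (L : Subfield Ω) {h : Polynomial Ω'} (hmon : h.Monic)
    (hcoeff : ∀ k, h.coeff k ∈ L.map ι) :
    ∃ f : Polynomial Ω, f.map ι = h ∧ f.Monic ∧ ∀ k, f.coeff k ∈ L := by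
  have hl : h ∈ Polynomial.lifts ι := by
    rw [Polynomial.lifts_iff_coeff_lifts]
    intro k
    obtain ⟨c, -, hc⟩ := Subfield.mem_map.mp (hcoeff k)
    exact ⟨c, hc⟩
  obtain ⟨f, hf, -, hfmon⟩ := Polynomial.lifts_and_degree_eq_and_monic hl hmon
  refine ⟨f, hf, hfmon, fun k => ?_⟩
  have hk : ι (f.coeff k) ∈ L.map ι := by
    rw [← Polynomial.coeff_map, hf]
    exact hcoeff k
  rwa [← Subfield.mem_comap, Subfield.comap_map] at hk

end Literature.AlgebraicGeometry.Resolution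

end
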